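import Summits.QuantumFields.BalabanUV.Beta.EriceFlowEnclosureB12AsPrintedPointwiseFadingLimitFloors
import Summits.QuantumFields.BalabanUV.Beta.EriceFlowEnclosureB12AsPrintedPointwiseFadingLimitSharp

/-!
# Beta / EriceFlowEnclosureB12AsPrintedPointwiseFadingLimitEnd — WHAT (0.31) FORCES, part 11c: THE ENDs ON THE AS-PRINTED CARRIER.  On [I]'s statement-exact typing `B12BetaAsPrinted`
# (`S : Setting`, `S.β` the history-dependent β-functions, `S.cpl P` the runs, `Theorem2Statement S hL` = Theorem 2 AS TYPED — constants β(g) ≤ β′(g) chosen AFTER the endpoint g — a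
# HYPOTHESIS, stated without proof in print), under prover 1's binder `hrg` and node U2's letters `HistLipschitz Λ γ_U S.β` ∕ `FadingMemory C θ Λ` ∕ `ScaleShiftRate c θ γ_U S.β` (0 ≤ θ < 1):
# §1 **`existsUnique_bstar`** — the letters ALONE give ONE number `b⋆` (`∃!`) with `|betaInf S.β (u,u,…) − b⋆| ≤ Cu∕(1−θ)` on ]0, γ_U] (parts 11∕11a′ BY NAME);
# §2 **`slopes_straddle_of_setting`** — whatever slopes `0 < s ≤ s′` make (0.31) hold along SOME family of runs of the setting inside ]0, γ_U] (one run per depth, relative to its own endpoint)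
#    satisfy `s ≤ b⋆ ≤ s′`; in particular **`bstar_pos_of_typedTheorem2`** (`0 < b⋆`) and **`typedTheorem2_constants_straddle`**: for every torus exponent m, every small box and every small
#    endpoint g, the constants `β(g) ≤ β′(g)` the typed Theorem 2 delivers obey `β(g) ln L ≤ b⋆ ≤ β′(g) ln L` — ALL of print's endpoint-dependent constant pairs straddle the SAME number;
# §3 **`sharp031_of_NE4`** — for every ε > 0 a box δ and a threshold k₀ such that EVERY run of the setting inside ]0, δ] obeys (0.31) on the scales ≥ k₀ with constants `b⋆ ∓ ε`;
# §4 **`bare_coupling_of_typedTheorem2`** — for Theorem 2's OWN ROWS pinned at any small endpoint g (any m): the tuned bare couplings satisfy **`K · g₀(K)² ⟶ 1∕b⋆`** — asymptotic freedom of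
#    the bare coupling with ONE coefficient for every pin and every torus exponent (part 11b's `tendsto_mul_bare_sq` with the floor from `b⋆ > 0`).
# So on node U2's hypotheses the typed (0.31) determines a canonical positive number — the common value of `lim_{u→0⁺} betaInf S.β (u,u,…)`, of `sup {eventual floors}`, of the sharp (0.31)
# constant and of `lim 1∕(K g₀(K)²)` — and β′∕β → 1 is forced (gen 46's open question, answered YES)
# (β-flow team, prover 2 = lower ∕ positivity side, unit `b2b-balaban-beta-bflow-p2`, gen 49; ROW AP-I; END of part 11)

HONEST FRAMING (page 1 of everything the β sub-cell writes): discharging `BetaPertH` makes Bałaban's UV stability UNCONDITIONAL — a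
real constructive-QFT result; it is NOT the continuum limit and NOT the Clay problem.  HONEST DEPENDENCY (cell reorg 2026-08-19,
verbatim): «continuum YM on T⁴ ⇐ BetaPertH ∧ nine spine estimates (0/9 proved); BetaPertH ⇐ (D1) ∧ (D4) ∧ CAP+tail; G-an2-4 gates
asym, D1 and NE2/3/4.»  THIS MODULE DISCHARGES NOTHING: bookkeeping BY NAME over parts 10∕11∕11a′∕11b and the NAMED FIELDS of `B12BetaAsPrinted` ([Balaban1987RG1] = T. Bałaban, Commun.
Math. Phys. **109** (1987) as typed; `Theorem2Statement` STATED WITHOUT PROOF in print, p. 259; [Balaban1989LargeFieldII] p. 355 «has not been published yet» — a HYPOTHESIS) under LETTERS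
displayed as hypotheses (`hrg`; `HistLipschitz ∕ FadingMemory ∕ ScaleShiftRate` — NOT printed: p. 298 says only that β_j *"depends also on all preceding coupling constants"*, p. 264 *"We will
investigate other properties in a separate paper"*; GAPS G-t4-U2-1 ∕ G-t4-U2-2).  `b⋆` is a real number with a displayed property, not a definition.  Nothing is asserted about Bałaban's
β-functions (1.22): NOT that they have such a limit at zero coupling, NOT its sign or value, NOT any modulus; NOT which reading of (0.31) print intends.

WHAT THIS FILE PROVES (0 sorry, 0 def): §1 **`existsUnique_bstar`**; §2 **`slopes_straddle_of_setting`**, **`bstar_pos_of_typedTheorem2`**, **`typedTheorem2_constants_straddle`**; §3 **`sharp031_of_NE4`**;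
§4 `small_box_floor`, **`bare_coupling_of_typedTheorem2`**; §5 `bstar_pos_of_typedTheorem2'` (`hrg` discharged from `Definitions` + (U)).
NOT CLAIMED: any letter, limit, sign or asymptotics for Bałaban's β or bare couplings; Theorem 2; `BetaPertH`; continuum; Clay.
-/

namespace Summit.QuantumFields.BalabanUV.Beta.EriceFlowEnclosureB12AsPrintedPointwiseFadingLimitEnd

open Finset Filter Topology
open Literature.MathematicalPhysics.QuantumFieldTheory.Balaban1983to89
open Literature.MathematicalPhysics.QuantumFieldTheory.Balaban1983to89.B12BetaAsPrinted
open Literature.MathematicalPhysics.QuantumFieldTheory.Balaban1983to89.FlowStep (HBeta prefixOf Box mem_box box_mono RGEqH BetaUpperH)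
open Literature.MathematicalPhysics.QuantumFieldTheory.Balaban1983to89.T4CouplingMatching (HistLipschitz FadingMemory ScaleShiftRate
  EventualLowerH)
open Literature.MathematicalPhysics.QuantumFieldTheory.Balaban1983to89.T4BetaStationary (SeqBox betaInf constant_nonneg_of_scaleShiftRate)
open Summit.QuantumFields.BalabanUV.Beta.EriceFlowEnclosureB12AsPrintedUpper (tunedRuns_of_theorem2Statement)
open Summit.QuantumFields.BalabanUV.Beta.EriceFlowEnclosureB12AsPrintedTunedUpper (hrg_of_betaUpperH)
open Summit.QuantumFields.BalabanUV.Beta.EriceFlowEnclosureB12AsPrintedPointwiseFadingDrift (runs_of_theorem2)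
open Summit.QuantumFields.BalabanUV.Beta.EriceFlowEnclosureB12AsPrintedPointwiseFadingLimit
open Summit.QuantumFields.BalabanUV.Beta.EriceFlowEnclosureB12AsPrintedPointwiseFadingLimitFloors
open Summit.QuantumFields.BalabanUV.Beta.EriceFlowEnclosureB12AsPrintedPointwiseFadingLimitSharp

noncomputable section

variable {S : Setting}

/-! ## §1 node U2's letters alone: THE asymptotic constant of the setting -/

/-- **THE ASYMPTOTIC CONSTANT OF THE SETTING (∃!).**  `HistLipschitz Λ γ_U S.β` with `FadingMemory C θ Λ` and `ScaleShiftRate c θ γ_U S.β` (0 ≤ θ < 1, 0 ≤ C, 0 < γ_U) ⟹ there is EXACTLY ONE real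
number `b⋆` with `|betaInf S.β (u,u,…) − b⋆| ≤ Cu∕(1−θ)` for all `u ∈ ]0, γ_U]` (parts 11 `exists_bstar` ∕ `bstar_unique` BY NAME).  No Theorem 2 here. [folklore] -/
theorem existsUnique_bstar {γU C c θ : ℝ} {Λ : ℕ → ℕ → ℝ} (hγU : 0 < γU) (hθ0 : 0 ≤ θ) (hθ1 : θ < 1) (hC : 0 ≤ C)
    (hLip : HistLipschitz Λ γU S.β) (hΛ : FadingMemory C θ Λ) (hS : ScaleShiftRate c θ γU S.β) :
    ∃! bstar : ℝ, ∀ u : ℝ, 0 < u → u ≤ γU → |betaInf S.β (fun _ : ℕ => u) - bstar| ≤ C * u / (1 - θ) := by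
  obtain ⟨bstar, hb⟩ := exists_bstar hLip hΛ hS hθ0 hθ1 hC hγU
  exact ⟨bstar, hb, fun b' hb' => bstar_unique hθ1 hC hγU hb' hb⟩

/-! ## §2 Whatever constants make (0.31) hold along some family of the setting's runs straddle `b⋆`; the typed Theorem 2 makes `b⋆ > 0` -/

/-- **ANY ADMISSIBLE PAIR OF (0.31)-CONSTANTS STRADDLES b⋆.**  Node U2's letters on ]0, γ_U] + `hrg` + `b⋆` (its displayed property `hb`) ⟹ if along SOME family of runs of the setting inside
]0, γ′] ⊆ ]0, γ_U] (one parameter P_K of depth K for every K) the discrete two-sided (0.31) holds with slopes `0 < s ≤ s′` relative to the runs' own endpoints, then `s ≤ b⋆ ≤ s′`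
(part 11a′ `slopes_straddle_bstar`). [cite: Balaban1987RG1, Thm 2 (0.31) p.259 with (0.20) p.256 and §5 p.298] -/
theorem slopes_straddle_of_setting {γU C c θ : ℝ} {Λ : ℕ → ℕ → ℝ} (hγU : 0 < γU) (hθ0 : 0 ≤ θ) (hθ1 : θ < 1) (hC : 0 ≤ C)
    (hrg : ∀ P : B12.RunParams, Step.InInterval γU P.K (S.cpl P) → RGEqH P.K S.β (S.cpl P))
    (hLip : HistLipschitz Λ γU S.β) (hΛ : FadingMemory C θ Λ) (hS : ScaleShiftRate c θ γU S.β) {bstar : ℝ}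
    (hb : ∀ u : ℝ, 0 < u → u ≤ γU → |betaInf S.β (fun _ : ℕ => u) - bstar| ≤ C * u / (1 - θ))
    {γ' s s' : ℝ} (hγ'U : γ' ≤ γU) (hs : 0 < s)
    (hfam : ∀ K : ℕ, ∃ P : B12.RunParams, P.K = K ∧ Step.InInterval γ' K (S.cpl P) ∧ Step.Discrete031 s s' K (S.cpl P K) (S.cpl P)) :
    s ≤ bstar ∧ bstar ≤ s' := by
  have hruns : ∀ K : ℕ, ∃ r : ℕ → ℝ, RGEqH K S.β r ∧ Step.InInterval γU K r ∧ Step.Discrete031 s s' K (r K) r := by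
    intro K
    obtain ⟨P, hPK, hI, hD⟩ := hfam K
    have hIU : Step.InInterval γU P.K (S.cpl P) := fun i hi => ⟨(hI i (hPK ▸ hi)).1, (hI i (hPK ▸ hi)).2.trans hγ'U⟩
    refine ⟨S.cpl P, ?_, fun i hi => hIU i (hPK.symm ▸ hi), ?_⟩
    · have := hrg P hIU; rwa [hPK] at this
    · exact hD
  exact slopes_straddle_bstar hLip hΛ hS hθ0 hθ1 hC hγU hb hs hruns

/-- **THE TYPED THEOREM 2 MAKES THE ASYMPTOTIC CONSTANT POSITIVE.**  `Theorem2Statement S hL` AS TYPED + `hrg` + node U2's letters on ]0, γ_U] ⟹ `0 < b⋆` (Theorem 2's family at ONE admissible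
endpoint, part 10's `runs_of_theorem2`, has a positive lower slope ≤ b⋆). [cite: Balaban1987RG1, Thm 2 (0.31) p.259 with (0.20) p.256 and §5 p.298] -/
theorem bstar_pos_of_typedTheorem2 {hL : Odd S.L ∧ 1 < S.L} (hT : Theorem2Statement S hL)
    {γU C c θ : ℝ} {Λ : ℕ → ℕ → ℝ} (hγU : 0 < γU) (hθ0 : 0 ≤ θ) (hθ1 : θ < 1) (hC : 0 ≤ C)
    (hrg : ∀ P : B12.RunParams, Step.InInterval γU P.K (S.cpl P) → RGEqH P.K S.β (S.cpl P))
    (hLip : HistLipschitz Λ γU S.β) (hΛ : FadingMemory C θ Λ) (hS : ScaleShiftRate c θ γU S.β) {bstar : ℝ}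
    (hb : ∀ u : ℝ, 0 < u → u ≤ γU → |betaInf S.β (fun _ : ℕ => u) - bstar| ≤ C * u / (1 - θ)) : 0 < bstar := by
  obtain ⟨s, s', hs, -, hruns⟩ := runs_of_theorem2 hT hγU hrg
  exact bstar_pos_of_runs hLip hΛ hS hθ0 hθ1 hC hγU hb hs hruns

/-- **ALL OF PRINT's ENDPOINT-DEPENDENT CONSTANT PAIRS STRADDLE THE SAME NUMBER.**  `Theorem2Statement S hL` AS TYPED + `hrg` + node U2's letters + `b⋆` ⟹ for every torus exponent m there is
γ₀ > 0 such that for every box `0 < γ ≤ min(γ₀, γ_U)` there is g₁ > 0 such that for every endpoint `0 < g ≤ g₁` the typed Theorem 2 delivers constants `0 < β ≤ β′` with its displayed run family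
(in ]0, γ], pinned at g, obeying (0.31)) AND `β ln L ≤ b⋆ ≤ β′ ln L`. [cite: Balaban1987RG1, Thm 2 (0.31) p.259 with (0.20) p.256 and §5 p.298] -/
theorem typedTheorem2_constants_straddle {hL : Odd S.L ∧ 1 < S.L} (hT : Theorem2Statement S hL)
    {γU C c θ : ℝ} {Λ : ℕ → ℕ → ℝ} (hγU : 0 < γU) (hθ0 : 0 ≤ θ) (hθ1 : θ < 1) (hC : 0 ≤ C)
    (hrg : ∀ P : B12.RunParams, Step.InInterval γU P.K (S.cpl P) → RGEqH P.K S.β (S.cpl P))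
    (hLip : HistLipschitz Λ γU S.β) (hΛ : FadingMemory C θ Λ) (hS : ScaleShiftRate c θ γU S.β) {bstar : ℝ}
    (hb : ∀ u : ℝ, 0 < u → u ≤ γU → |betaInf S.β (fun _ : ℕ => u) - bstar| ≤ C * u / (1 - θ)) (m : ℕ) :
    ∃ γ₀ : ℝ, 0 < γ₀ ∧ ∀ γ : ℝ, 0 < γ → γ ≤ γ₀ → γ ≤ γU → ∃ g₁ : ℝ, 0 < g₁ ∧ ∀ g : ℝ, 0 < g → g ≤ g₁ →
      ∃ β β' : ℝ, 0 < β ∧ β ≤ β' ∧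
        (∀ K : ℕ, ∃ g₀ : ℝ, Step.InInterval γ K (S.cpl ⟨K, m, g₀⟩) ∧ S.cpl ⟨K, m, g₀⟩ K = g ∧
          Step.Discrete031 (β * Real.log S.L) (β' * Real.log S.L) K g (S.cpl ⟨K, m, g₀⟩)) ∧
        β * Real.log S.L ≤ bstar ∧ bstar ≤ β' * Real.log S.L := by
  have hlog : 0 < Real.log (S.L : ℝ) := Real.log_pos (by exact_mod_cast hL.2)
  obtain ⟨γ₀, hγ₀, hγ⟩ := tunedRuns_of_theorem2Statement hT m
  refine ⟨γ₀, hγ₀, fun γ hγpos hγle hγU' => ?_⟩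
  obtain ⟨g₁, hg₁, hg⟩ := hγ γ hγpos hγle
  refine ⟨g₁, hg₁, fun g hgpos hgle => ?_⟩
  obtain ⟨β, β', hβ, hββ', hK⟩ := hg g hgpos hgle
  refine ⟨β, β', hβ, hββ', hK, ?_⟩
  have hfam : ∀ K : ℕ, ∃ P : B12.RunParams, P.K = K ∧ Step.InInterval γ K (S.cpl P) ∧
      Step.Discrete031 (β * Real.log S.L) (β' * Real.log S.L) K (S.cpl P K) (S.cpl P) := by
    intro K
    obtain ⟨g₀, hI, hend, hD⟩ := hK K
    exact ⟨⟨K, m, g₀⟩, rfl, hI, by rw [hend]; exact hD⟩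
  exact slopes_straddle_of_setting hγU hθ0 hθ1 hC hrg hLip hΛ hS hb hγU' (mul_pos hβ hlog) hfam

/-! ## §3 The eventual sharp (0.31) for every run of the setting -/

/-- **THE EVENTUAL SHARP (0.31) ON THE CARRIER.**  Node U2's letters on ]0, γ_U] + `hrg` + `b⋆` ⟹ for every ε > 0 there are a box `0 < δ ≤ γ_U` and a threshold k₀ such that EVERY run of the setting
lying in ]0, δ] up to its depth (any torus exponent, any depth, any bare coupling) obeys `(b⋆ − ε)(n − k) ≤ 1∕g_k² − 1∕g_n² ≤ (b⋆ + ε)(n − k)` for all `k₀ ≤ k ≤ n ≤ K` (part 11b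
`exists_sharp031`).  With `b⋆ > 0` (§2): β′∕β → 1. [cite: Balaban1987RG1, Thm 2 (0.31) p.259 with (0.20) p.256 and §5 p.298] -/
theorem sharp031_of_NE4 {γU C c θ : ℝ} {Λ : ℕ → ℕ → ℝ} (hγU : 0 < γU) (hθ0 : 0 ≤ θ) (hθ1 : θ < 1) (hC : 0 ≤ C)
    (hrg : ∀ P : B12.RunParams, Step.InInterval γU P.K (S.cpl P) → RGEqH P.K S.β (S.cpl P))
    (hLip : HistLipschitz Λ γU S.β) (hΛ : FadingMemory C θ Λ) (hS : ScaleShiftRate c θ γU S.β) {bstar : ℝ}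
    (hb : ∀ u : ℝ, 0 < u → u ≤ γU → |betaInf S.β (fun _ : ℕ => u) - bstar| ≤ C * u / (1 - θ)) {ε : ℝ} (hε : 0 < ε) :
    ∃ δ : ℝ, 0 < δ ∧ δ ≤ γU ∧ ∃ k₀ : ℕ, ∀ P : B12.RunParams, Step.InInterval δ P.K (S.cpl P) →
      ∀ k n : ℕ, k₀ ≤ k → k ≤ n → n ≤ P.K →
        (bstar - ε) * ((n : ℝ) - k) ≤ 1 / (S.cpl P k) ^ 2 - 1 / (S.cpl P n) ^ 2 ∧
          1 / (S.cpl P k) ^ 2 - 1 / (S.cpl P n) ^ 2 ≤ (bstar + ε) * ((n : ℝ) - k) := by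
  obtain ⟨δ, hδ, hδγ, k₀, h⟩ := exists_sharp031 hLip hΛ hS hθ0 hθ1 hC hγU hb hε
  refine ⟨δ, hδ, hδγ, k₀, fun P hI k n hk hkn hn => ?_⟩
  have hIU : Step.InInterval γU P.K (S.cpl P) := fun i hi => ⟨(hI i hi).1, (hI i hi).2.trans hδγ⟩
  exact h P.K (S.cpl P) (hrg P hIU) hI k n hk hkn hn

/-! ## §4 The bare couplings of Theorem 2's rows: `K · g₀(K)² → 1∕b⋆` for every small pin and every torus exponent -/

/-- The floor near zero from `b⋆ > 0` (part 11b `eventualLowerH_of_bstar_pos` with an explicit box and threshold): there are `0 < δ₁ ≤ γ_U` and k₁ with `EventualLowerH (b⋆∕4) δ₁ k₁ S.β`. [folklore] -/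
theorem small_box_floor {γU C c θ : ℝ} {Λ : ℕ → ℕ → ℝ} (hγU : 0 < γU) (hθ0 : 0 ≤ θ) (hθ1 : θ < 1) (hC : 0 ≤ C)
    (hLip : HistLipschitz Λ γU S.β) (hΛ : FadingMemory C θ Λ) (hS : ScaleShiftRate c θ γU S.β) {bstar : ℝ}
    (hb : ∀ u : ℝ, 0 < u → u ≤ γU → |betaInf S.β (fun _ : ℕ => u) - bstar| ≤ C * u / (1 - θ)) (hpos : 0 < bstar) :
    ∃ δ₁ : ℝ, 0 < δ₁ ∧ δ₁ ≤ γU ∧ ∃ k₁ : ℕ, EventualLowerH (bstar / 4) δ₁ k₁ S.β := by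
  have h1θ : 0 < 1 - θ := by linarith
  have hc : 0 ≤ c := constant_nonneg_of_scaleShiftRate hS hγU
  set δ₁ : ℝ := min γU (bstar * (1 - θ) / (4 * (C + 1))) with hδ₁def
  have hδ₁ : 0 < δ₁ := lt_min hγU (by positivity)
  have hδ₁γ : δ₁ ≤ γU := min_le_left _ _
  have hsmall : 4 * C * δ₁ ≤ bstar * (1 - θ) := by
    have h1 : δ₁ ≤ bstar * (1 - θ) / (4 * (C + 1)) := min_le_right _ _
    have h2 : 4 * (C + 1) * δ₁ ≤ bstar * (1 - θ) := by rwa [le_div_iff₀ (by positivity), mul_comm] at h1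
    nlinarith [hδ₁.le]
  obtain ⟨k₁, hk₁⟩ : ∃ k₁ : ℕ, c * θ ^ k₁ ≤ (1 - θ) * bstar / 4 := by
    rcases eq_or_lt_of_le hc with h0 | hcpos
    · exact ⟨0, by rw [← h0]; simp; positivity⟩
    · obtain ⟨k, hk⟩ := exists_pow_lt_of_lt_one (show 0 < (1 - θ) * bstar / 4 / c by positivity) hθ1
      exact ⟨k, by have := (lt_div_iff₀ hcpos).mp hk; linarith⟩
  exact ⟨δ₁, hδ₁, hδ₁γ, k₁, eventualLowerH_of_bstar_pos hLip hΛ hS hθ0 hθ1 hC hb hδ₁ hδ₁γ hsmall hk₁⟩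

/-- **THE BARE COUPLINGS OF THEOREM 2's ROWS ARE ASYMPTOTICALLY FREE WITH THE ONE COEFFICIENT b⋆.**  `Theorem2Statement S hL` AS TYPED + `hrg` + node U2's letters on ]0, γ_U] + `b⋆` ⟹ there is a
box `0 < δ₁ ≤ γ_U` such that for every torus exponent m, below Theorem 2's own threshold γ₀(m), for every box `γ ≤ min(γ₀, δ₁)` and every admissible pin g: the tuned bare couplings
`g₀(K) = g₀(L^{−K}, g)` of the displayed family (rows in ]0, γ] pinned at g) satisfy **`K · g₀(K)² ⟶ 1∕b⋆`** — the same coefficient for every pin and every m (part 11b `tendsto_mul_bare_sq`;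
the floor from `small_box_floor`, `b⋆ > 0` from §2). [cite: Balaban1987RG1, Thm 2 (0.31) p.259 with (0.20) p.256 and §5 p.298] -/
theorem bare_coupling_of_typedTheorem2 {hL : Odd S.L ∧ 1 < S.L} (hT : Theorem2Statement S hL)
    {γU C c θ : ℝ} {Λ : ℕ → ℕ → ℝ} (hγU : 0 < γU) (hθ0 : 0 ≤ θ) (hθ1 : θ < 1) (hC : 0 ≤ C)
    (hrg : ∀ P : B12.RunParams, Step.InInterval γU P.K (S.cpl P) → RGEqH P.K S.β (S.cpl P))
    (hLip : HistLipschitz Λ γU S.β) (hΛ : FadingMemory C θ Λ) (hS : ScaleShiftRate c θ γU S.β) {bstar : ℝ}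
    (hb : ∀ u : ℝ, 0 < u → u ≤ γU → |betaInf S.β (fun _ : ℕ => u) - bstar| ≤ C * u / (1 - θ)) :
    ∃ δ₁ : ℝ, 0 < δ₁ ∧ δ₁ ≤ γU ∧ ∀ m : ℕ, ∃ γ₀ : ℝ, 0 < γ₀ ∧ ∀ γ : ℝ, 0 < γ → γ ≤ γ₀ → γ ≤ δ₁ →
      ∃ g₁ : ℝ, 0 < g₁ ∧ ∀ g : ℝ, 0 < g → g ≤ g₁ → ∃ g₀ : ℕ → ℝ,
        (∀ K : ℕ, Step.InInterval γ K (S.cpl ⟨K, m, g₀ K⟩) ∧ S.cpl ⟨K, m, g₀ K⟩ K = g) ∧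
        Tendsto (fun K : ℕ => (K : ℝ) * (S.cpl ⟨K, m, g₀ K⟩ 0) ^ 2) atTop (𝓝 (1 / bstar)) := by
  have hpos := bstar_pos_of_typedTheorem2 hT hγU hθ0 hθ1 hC hrg hLip hΛ hS hb
  obtain ⟨δ₁, hδ₁, hδ₁γ, k₁, hfl⟩ := small_box_floor hγU hθ0 hθ1 hC hLip hΛ hS hb hpos
  refine ⟨δ₁, hδ₁, hδ₁γ, fun m => ?_⟩
  obtain ⟨γ₀, hγ₀, hγ⟩ := tunedRuns_of_theorem2Statement hT m
  refine ⟨γ₀, hγ₀, fun γ hγpos hγle hγδ₁ => ?_⟩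
  obtain ⟨g₁, hg₁, hg⟩ := hγ γ hγpos hγle
  refine ⟨g₁, hg₁, fun g hgpos hgle => ?_⟩
  obtain ⟨β, β', -, -, hK⟩ := hg g hgpos hgle
  choose g₀ hI hend _ using hK
  refine ⟨g₀, fun K => ⟨hI K, hend K⟩, ?_⟩
  have hIδ : ∀ K, Step.InInterval δ₁ K (S.cpl ⟨K, m, g₀ K⟩) := fun K i hi => ⟨(hI K i hi).1, (hI K i hi).2.trans hγδ₁⟩
  have hIU : ∀ K, Step.InInterval γU K (S.cpl ⟨K, m, g₀ K⟩) := fun K i hi => ⟨(hIδ K i hi).1, (hIδ K i hi).2.trans hδ₁γ⟩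
  have hrun : ∀ K, RGEqH K S.β (S.cpl ⟨K, m, g₀ K⟩) := fun K => hrg ⟨K, m, g₀ K⟩ (hIU K)
  exact tendsto_mul_bare_sq (r := fun K => S.cpl ⟨K, m, g₀ K⟩) hLip hΛ hS hθ0 hθ1 hC hb hpos.ne' hδ₁ hδ₁γ hfl (by positivity) hrun hIδ hend

/-! ## §5 `hrg` discharged -/

/-- §2's positivity with prover 1's binder `hrg` DISCHARGED from the printed `Definitions` and the upper letter (U) `BetaUpperH M γ_U S.β` with `Mγ_U² < 1` (`…TunedUpper.hrg_of_betaUpperH`).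
[cite: Balaban1987RG1, Thm 2 (0.31) p.259 with §1 p.264] -/
theorem bstar_pos_of_typedTheorem2' {hL : Odd S.L ∧ 1 < S.L} (hT : Theorem2Statement S hL) (hDef : Definitions S)
    {γU C c θ M : ℝ} {Λ : ℕ → ℕ → ℝ} (hγU : 0 < γU) (hθ0 : 0 ≤ θ) (hθ1 : θ < 1) (hC : 0 ≤ C)
    (hub : BetaUpperH M γU S.β) (hMγ : M * γU ^ 2 < 1)
    (hLip : HistLipschitz Λ γU S.β) (hΛ : FadingMemory C θ Λ) (hS : ScaleShiftRate c θ γU S.β) {bstar : ℝ}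
    (hb : ∀ u : ℝ, 0 < u → u ≤ γU → |betaInf S.β (fun _ : ℕ => u) - bstar| ≤ C * u / (1 - θ)) : 0 < bstar :=
  bstar_pos_of_typedTheorem2 hT hγU hθ0 hθ1 hC (hrg_of_betaUpperH hDef hγU hub hMγ) hLip hΛ hS hb

end

end Summit.QuantumFields.BalabanUV.Beta.EriceFlowEnclosureB12AsPrintedPointwiseFadingLimitEnd
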